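import Literature.Geometry.Kaehler.ComplexTorusKernelIdeals
import HarnessLib

/-!
# `End(X/H(I))` is the right order of the kernel ideal `I` (Kieffer 2024 §1.4.1, Proposition 1.4.7)

For a complex torus `X = ComplexTorus Φ` (`Φ : (ι → ℝ) ≃L[ℝ] E`, `End(X) = endRingInt Φ ⊆ M_ι(ℤ)`,
`End⁰(X) = endAlgRat Φ ⊆ M_ι(ℚ)`), a finite subgroup `K ≤ X` and the quotient torus `X/K` of
`ComplexTorusQuotientFiniteSubgroup` (period `quotientByPeriod Φ K` on the same covering space `E`, quotient
isogeny `φ_K = mapMatrix Φ (quotientByPeriod Φ K) Q` with rational representation `Q = quotientMatrix Φ K`,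
analytic representation `id_E` and kernel exactly `K`), we formalize, at torus level, the last result of §1.4.1
of Kieffer's notes (after Waterhouse [Wat69, §3]):

> "One convenient feature of this construction is that is works well with respect to the (compatible)
> multiplication of ideals. By Proposition 1.1.25, if `φ : A → B` is any isogeny, we can identify `End(B)` with
> a subring of `End⁰(A)` as follows: choose `n ≥ 1` and an isogeny `ψ : B → A` such that `φ_I ∘ ψ = [n]_A` and
> `ψ ∘ φ_I = [n]_B`. Then we define the map `η : End(B) → End⁰(A)`, `α ↦ (1/n) ψ ∘ α ∘ φ_I`. This map is
> independent of the choice of `n` and `ψ`." [Kieffer2024IsogenyGraphs, p. 44]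
>
> "Finally, when `I` is a kernel ideal, we can describe the endomorphism ring of `A/H(I)`:
> **Proposition 1.4.7.** Let `I ⊂ End(A)` be a kernel ideal. Then the endomorphism ring of `A/H(I)`, seen as a
> subring of `End⁰(A)`, is precisely the right order of `I`.
> *Proof.* We again use the local-global principle: for each prime `ℓ ≠ p`, we check that the endomorphism
> ring of `A/H(I)` equals the right order of `I` after tensoring with `ℤ_ℓ`. […] By Tate's isogeny theorem
> 1.2.11, the subring of `End(A/H(I)) ⊗ ℤ_ℓ ⊂ End⁰(A) ⊗_ℚ ℚ_ℓ` consists of those elements `α` such that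
> `V_ℓ(α)(⋂_{τ ∈ I} V_ℓ(τ)⁻¹(T_ℓ(A))) ⊂ ⋂_{τ ∈ I} V_ℓ(τ)⁻¹(T_ℓ(A))`. Equivalently, for each `σ ∈ I`, we have
> `V_ℓ(σα)(⋂_{τ ∈ I} V_ℓ(τ)⁻¹(T_ℓ(A))) ⊂ T_ℓ(A)`. (1) In particular, `V_ℓ(σα)(T_ℓ(A)) ⊂ T_ℓ(A)`, so
> `σα ∈ End(A)`. […] If `α` lies in the right order of `I`, then (1) is satisfied for each `σ`, as `σα ∈ I`.
> Conversely, if the above condition holds, then `I + Iα` is an ideal of `End(A)` with `H(I + Iα) = H(I)`.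
> Because `I` is a kernel ideal, we have `Iα ⊂ I`, i.e. `α` lies in the right order of `I`."
> [Kieffer2024IsogenyGraphs, pp. 45–46]

**Torus-level proof.** Over `ℂ` no local–global principle is needed: in the lattice coordinates of
`X = ℝ^ι/ℤ^ι` the quotient `X/H(I)` is `ℝ^ι/Λ′` with the GLOBAL over-lattice
`Λ′ = π⁻¹(H(I)) = Q_ℝ⁻¹(ℤ^ι) = {x : σ_ℝ x ∈ ℤ^ι for all σ ∈ I}` (`proj_mem_iff_exists_quotientMatrix_mulVec_eq`,
`proj_mem_kernelSubgroup_iff`), which plays the role of `⋂_τ V_ℓ(τ)⁻¹ T_ℓ(A)` for all `ℓ` at once, and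
`η(γ) = Q⁻¹ γ Q` reads an endomorphism `γ` of `X/K` (an integer matrix in the coordinates of `Λ′ = Q_ℝ⁻¹ ℤ^ι`)
in the rational coordinates of `X`.  Kieffer's two inclusions are then proved word for word:
`⊆` (`range_quotientEndHom_le_rightOrder`, for the ideal `I(K)` of ANY finite `K`): for `σ ∈ I(K)` the matrix
`σ·η(γ)` maps `ℤ^ι ⊆ Λ′` into `σ(Λ′) ⊆ ℤ^ι`, so it is integral ("`σα ∈ End(A)`"), it commutes with `J`, and it
kills `K`, i.e. `σ·η(γ) ∈ I(K)`; `⊇` (`rightOrder_le_range_quotientEndHom`, for every `I` with `H(I)` finite): if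
`σM = τ_σ ∈ I` for all `σ ∈ I` then `M_ℝ(Λ′) ⊆ Λ′`, so `γ = Q M Q⁻¹` is integral and commutes with
`J_{X/H(I)} = Q J_Φ Q⁻¹` (`jMatrix_quotientPeriod_mul`), i.e. `γ ∈ End(X/H(I))` with `η(γ) = M`.  For a kernel
ideal (`I(H(I)) = I`) the two give Proposition 1.4.7.

## Contents (namespace `Literature.Geometry.Kaehler.ComplexTorus`)

* §1 `proj_mem_iff_exists_quotientMatrix_mulVec_eq` (`π(x) ∈ K ↔ Q_ℝ x ∈ ℤ^ι`), `quotientMatrixRat`,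
  `isUnit_det_quotientMatrixRat`, `quotientPeriod_symm_apply`, `latticeJ_quotientPeriod_mulVec`,
  **`jMatrix_quotientPeriod_mul`** (`J_{Φ∘A_ℝ⁻¹} A_ℝ = A_ℝ J_Φ`: the complex structure of `X/Ker ρ(A)`).
* §2 **`quotientEndHom Φ K : endRingInt (quotientByPeriod Φ K) →+* Matrix ι ι ℚ`** (Kieffer's `η`,
  `γ ↦ Q⁻¹ γ Q`), `quotientMatrixRat_mul_quotientEndHom` (`Q η(γ) = γ Q`), `quotientEndHom_mem_endAlgRat`
  (`η(γ) ∈ End⁰(X)`), `quotientEndHom_injective`, `quotientMatrix_mulVec_quotientEndHom_mulVec` /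
  `proj_quotientEndHom_mulVec_mem` (`η(γ)` preserves `π⁻¹(K)`).
* §3 **`rightOrder Φ I : Subring (Matrix ι ι ℚ)`** (`O_r(I) = {M ∈ End⁰(X) : IM ⊆ I}`), `mem_rightOrder_iff`,
  `rightOrder_le_endAlgRat`, `map_intCast_mem_rightOrder_iff`, `map_intCast_mem_rightOrder_of_comm`.
* §4 `range_quotientEndHom_le_rightOrder` (`η(End(X/K)) ⊆ O_r(I(K))`), `proj_mem_kernelSubgroup_iff`,
  `rightOrder_le_range_quotientEndHom` (`O_r(I) ⊆ η(End(X/H(I)))`), `exists_quotientEndHom_eq_of_comm`;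
  **`IsKernelIdeal.range_quotientEndHom_eq`** (PROPOSITION 1.4.7: `η(End(X/H(I))) = O_r(I)`),
  `IsKernelIdeal.mem_rightOrder_iff`, **`IsKernelIdeal.quotientEndEquivRightOrder : End(X/H(I)) ≃+* O_r(I)`**,
  `IsKernelIdeal.coe_quotientEndEquivRightOrder`.

No named facts are introduced (definitions with bodies and proved theorems only).

## References

* [Kieffer2024IsogenyGraphs] J. Kieffer, *Isogeny graphs in higher dimensions* (lecture notes, 2024), §1.4.1,
  the map `η` (p. 44) and Proposition 1.4.7 with proof (pp. 45–46); after W. C. Waterhouse, *Abelian varieties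
  over finite fields*, Ann. Sci. ÉNS (4) 2 (1969), 521–560, §3.
* [Lange2023AbelianVarietiesComplex] H. Lange, *Abelian Varieties over the Complex Numbers*, Springer 2023, §1.1.2
  (analytic and rational representations; `X/Γ = V/π⁻¹(Γ)`).
-/

noncomputable section

open Module Function
open scoped Matrix

namespace Literature.Geometry.Kaehler

namespace ComplexTorus

variable {ι : Type*} [Fintype ι] [DecidableEq ι] {E : Type*} [NormedAddCommGroup E] [NormedSpace ℂ E]
  (Φ : (ι → ℝ) ≃L[ℝ] E)

/-! ## §0 Casts of integer and rational matrices -/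

omit [Fintype ι] [DecidableEq ι] in
/-- `ℤ → ℚ → ℝ` casts of an integer matrix. [folklore] -/
private theorem map_intCast_map_ratCast (A : Matrix ι ι ℤ) :
    (A.map (Int.cast : ℤ → ℚ)).map (Rat.cast : ℚ → ℝ) = A.map (Int.cast : ℤ → ℝ) :=
  Matrix.ext fun i j ↦ Rat.cast_intCast (A i j)

omit [DecidableEq ι] in
/-- Entrywise cast `ℚ → ℝ` of a product. [folklore] -/
private theorem map_ratCast_mul (A B : Matrix ι ι ℚ) :
    (A * B).map (Rat.cast : ℚ → ℝ) = A.map (Rat.cast : ℚ → ℝ) * B.map (Rat.cast : ℚ → ℝ) :=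
  Matrix.map_mul (f := Rat.castHom ℝ)

omit [DecidableEq ι] in
/-- Entrywise cast `ℤ → ℚ` of a product. [folklore] -/
private theorem map_intCast_mul_rat (A B : Matrix ι ι ℤ) :
    (A * B).map (Int.cast : ℤ → ℚ) = A.map (Int.cast : ℤ → ℚ) * B.map (Int.cast : ℤ → ℚ) :=
  Matrix.map_mul (f := Int.castRingHom ℚ)

omit [DecidableEq ι] in
/-- Entrywise cast `ℤ → ℝ` of a product. [folklore] -/
private theorem map_intCast_mul_real (A B : Matrix ι ι ℤ) :
    (A * B).map (Int.cast : ℤ → ℝ) = A.map (Int.cast : ℤ → ℝ) * B.map (Int.cast : ℤ → ℝ) :=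
  Matrix.map_mul (f := Int.castRingHom ℝ)

/-- A real matrix whose columns are integer vectors is (the real extension of) an integer matrix. [folklore] -/
private theorem exists_map_intCast_eq_of_mulVec_single {C : Matrix ι ι ℝ} {k : ι → ι → ℤ}
    (h : ∀ j, C *ᵥ Pi.single j 1 = intVec (k j)) : (Matrix.of fun i j ↦ k j i).map (Int.cast : ℤ → ℝ) = C :=
  Matrix.ext fun i j ↦ by
    have hC : (C *ᵥ Pi.single j (1 : ℝ)) i = C i j := by
      simp
    have hij := congrFun (h j) i
    rw [hC] at hij
    simp only [Matrix.map_apply, Matrix.of_apply, hij, intVec]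

/-! ## §1 The quotient torus `X/K`: lattice `π⁻¹(K) = Q_ℝ⁻¹ ℤ^ι` and complex structure -/

section Quotient

variable (K : AddSubgroup (ComplexTorus Φ)) [Finite K]

/-- **`π⁻¹(K) = Q_ℝ⁻¹(ℤ^ι)`**: `π(x) ∈ K ↔ Q_ℝ x ∈ ℤ^ι` for the rational representation
`Q = quotientMatrix Φ K` of the quotient isogeny `φ_K : X → X/K` (its kernel is exactly `K`).
[cite: Kieffer2024IsogenyGraphs, §1.4.1 Def. 1.4.1 ("the quotient isogeny `φ_I : A → A/H(I)`"), p. 43]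
[cite: Lange2023AbelianVarietiesComplex, §1.1.2 ("`X/Γ = V/π⁻¹(Γ)`")] -/
theorem proj_mem_iff_exists_quotientMatrix_mulVec_eq (x : ι → ℝ) :
    proj Φ x ∈ K ↔ ∃ n : ι → ℤ, (quotientMatrix Φ K).map (Int.cast : ℤ → ℝ) *ᵥ x = intVec n := by
  have h := proj_mem_ker_mapMatrixHom_iff Φ (quotientByPeriod Φ K) (quotientMatrix Φ K) x
  rw [ker_mapMatrixHom_quotientBy] at h
  exact h

/-- The rational representation `Q_K ∈ M_ι(ℚ)` of `φ_K : X → X/K`.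
[cite: Kieffer2024IsogenyGraphs, §1.4.1 (the map `η`), p. 44] -/
abbrev quotientMatrixRat : Matrix ι ι ℚ := (quotientMatrix Φ K).map (Int.cast : ℤ → ℚ)

/-- `det Q_K ≠ 0` in `ℚ`: `Q_K` is invertible in `M_ι(ℚ)` (an isogeny).
[cite: Kieffer2024IsogenyGraphs, §1.4.1 (the map `η`: "choose `n ≥ 1` and an isogeny `ψ : B → A` such that `φ_I ∘ ψ = [n]_A`"), p. 44] -/
theorem isUnit_det_quotientMatrixRat : IsUnit (quotientMatrixRat Φ K).det := by
  change IsUnit ((quotientMatrix Φ K).map (Int.cast : ℤ → ℚ)).det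
  rw [← Int.cast_det]
  exact (Int.cast_ne_zero.2 (det_quotientMatrix_ne_zero Φ K)).isUnit

/-- `Q_ℚ` realified is `Q_ℝ`. [folklore] -/
private theorem quotientMatrixRat_map :
    (quotientMatrixRat Φ K).map (Rat.cast : ℚ → ℝ) = (quotientMatrix Φ K).map (Int.cast : ℤ → ℝ) :=
  map_intCast_map_ratCast _

end Quotient

section QuotientPeriodJ

variable (A : Matrix ι ι ℤ) (hA : A.det ≠ 0)

/-- `(Φ ∘ A_ℝ⁻¹)⁻¹ = A_ℝ ∘ Φ⁻¹`. [cite: Lange2023AbelianVarietiesComplex, §1.1.2 ("`X/Γ = V/π⁻¹(Γ)`")] -/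
theorem quotientPeriod_symm_apply (e : E) :
    (quotientPeriod Φ A hA).symm e = A.map (Int.cast : ℤ → ℝ) *ᵥ Φ.symm e := by
  rw [ContinuousLinearEquiv.symm_apply_eq, quotientPeriod_mulVec, ContinuousLinearEquiv.apply_symm_apply]

/-- **The complex structure of `X/Ker ρ(A)` in its own lattice coordinates is `A_ℝ J_Φ A_ℝ⁻¹`**:
`J_{Φ ∘ A_ℝ⁻¹} (A_ℝ x) = A_ℝ (J_Φ x)` (the quotient map has analytic representation `id_E`, which is
`ℂ`-linear). [cite: Lange2023AbelianVarietiesComplex, §1.1.2 (analytic and rational representations; "the natural projection `p : X → X/Γ`")] -/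
theorem latticeJ_quotientPeriod_mulVec (x : ι → ℝ) :
    latticeJ (quotientPeriod Φ A hA) (A.map (Int.cast : ℤ → ℝ) *ᵥ x) = A.map (Int.cast : ℤ → ℝ) *ᵥ latticeJ Φ x := by
  rw [latticeJ_apply, latticeJ_apply, quotientPeriod_mulVec, quotientPeriod_symm_apply]

/-- Matrix form: `J_{Φ ∘ A_ℝ⁻¹} · A_ℝ = A_ℝ · J_Φ`. [cite: Lange2023AbelianVarietiesComplex, §1.1.2 (analytic and rational representations)] -/
theorem jMatrix_quotientPeriod_mul :
    jMatrix (quotientPeriod Φ A hA) * A.map (Int.cast : ℤ → ℝ) = A.map (Int.cast : ℤ → ℝ) * jMatrix Φ :=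
  Matrix.ext_iff_mulVec.2 fun x ↦ by
    rw [← Matrix.mulVec_mulVec, ← Matrix.mulVec_mulVec, jMatrix_mulVec, jMatrix_mulVec,
      latticeJ_quotientPeriod_mulVec]

end QuotientPeriodJ

/-! ## §2 Kieffer's `η : End(X/K) ↪ End⁰(X)`, `γ ↦ Q⁻¹ γ Q` -/

section Eta

variable (K : AddSubgroup (ComplexTorus Φ)) [Finite K]

/-- **`η : End(B) → End⁰(A)`, `α ↦ (1/n) ψ ∘ α ∘ φ_I`** for `B = X/K`, at torus level: with `Q = Q_K` the
rational representation of `φ_K : X → X/K` (and `ψ = n Q⁻¹`), `η(γ) = Q⁻¹ γ Q ∈ M_ι(ℚ)` — the endomorphism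
`γ` of `X/K` read in the rational coordinates of `X` (a ring homomorphism).
[cite: Kieffer2024IsogenyGraphs, §1.4.1 (before Lemma 1.4.4: "we can identify `End(B)` with a subring of `End⁰(A)` … `η : End(B) → End⁰(A)`, `α ↦ (1/n) ψ ∘ α ∘ φ_I`. This map is independent of the choice of `n` and `ψ`."), p. 44] -/
def quotientEndHom : endRingInt (quotientByPeriod Φ K) →+* Matrix ι ι ℚ where
  toFun γ := (quotientMatrixRat Φ K)⁻¹ * (γ : Matrix ι ι ℤ).map (Int.cast : ℤ → ℚ) * quotientMatrixRat Φ K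
  map_one' := by
    rw [OneMemClass.coe_one, Matrix.map_one Int.cast Int.cast_zero Int.cast_one, Matrix.mul_one]
    exact Matrix.nonsing_inv_mul _ (isUnit_det_quotientMatrixRat Φ K)
  map_mul' γ δ := by
    rw [Subring.coe_mul, map_intCast_mul_rat]
    symm
    calc (quotientMatrixRat Φ K)⁻¹ * (γ : Matrix ι ι ℤ).map (Int.cast : ℤ → ℚ) * quotientMatrixRat Φ K *
          ((quotientMatrixRat Φ K)⁻¹ * (δ : Matrix ι ι ℤ).map (Int.cast : ℤ → ℚ) * quotientMatrixRat Φ K)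
        = (quotientMatrixRat Φ K)⁻¹ * (γ : Matrix ι ι ℤ).map (Int.cast : ℤ → ℚ) *
            (quotientMatrixRat Φ K * ((quotientMatrixRat Φ K)⁻¹ * ((δ : Matrix ι ι ℤ).map (Int.cast : ℤ → ℚ) *
              quotientMatrixRat Φ K))) := by simp only [Matrix.mul_assoc]
      _ = (quotientMatrixRat Φ K)⁻¹ * ((γ : Matrix ι ι ℤ).map (Int.cast : ℤ → ℚ) * (δ : Matrix ι ι ℤ).map (Int.cast : ℤ → ℚ)) *
            quotientMatrixRat Φ K := by
        rw [Matrix.mul_nonsing_inv_cancel_left _ _ (isUnit_det_quotientMatrixRat Φ K)]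
        simp only [Matrix.mul_assoc]
  map_zero' := by
    rw [ZeroMemClass.coe_zero, Matrix.map_zero Int.cast Int.cast_zero, Matrix.mul_zero, Matrix.zero_mul]
  map_add' γ δ := by
    rw [Subring.coe_add, Matrix.map_add Int.cast Int.cast_add, Matrix.mul_add, Matrix.add_mul]

/-- `η(γ) = Q⁻¹ γ Q`. [cite: Kieffer2024IsogenyGraphs, §1.4.1 (the map `η`), p. 44] -/
theorem quotientEndHom_apply (γ : endRingInt (quotientByPeriod Φ K)) :
    quotientEndHom Φ K γ = (quotientMatrixRat Φ K)⁻¹ * (γ : Matrix ι ι ℤ).map (Int.cast : ℤ → ℚ) * quotientMatrixRat Φ K :=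
  rfl

/-- **`Q · η(γ) = γ · Q`** (`φ_K ∘ η(γ) = γ ∘ φ_K` in rational representations).
[cite: Kieffer2024IsogenyGraphs, §1.4.1 (the map `η`), p. 44] -/
theorem quotientMatrixRat_mul_quotientEndHom (γ : endRingInt (quotientByPeriod Φ K)) :
    quotientMatrixRat Φ K * quotientEndHom Φ K γ = (γ : Matrix ι ι ℤ).map (Int.cast : ℤ → ℚ) * quotientMatrixRat Φ K := by
  rw [quotientEndHom_apply, Matrix.mul_assoc, Matrix.mul_nonsing_inv_cancel_left _ _ (isUnit_det_quotientMatrixRat Φ K)]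

/-- Real form: `Q_ℝ · η(γ)_ℝ = γ_ℝ · Q_ℝ`. [cite: Kieffer2024IsogenyGraphs, §1.4.1 (the map `η`), p. 44] -/
theorem quotientMatrix_mul_quotientEndHom_map (γ : endRingInt (quotientByPeriod Φ K)) :
    (quotientMatrix Φ K).map (Int.cast : ℤ → ℝ) * (quotientEndHom Φ K γ).map (Rat.cast : ℚ → ℝ) =
      (γ : Matrix ι ι ℤ).map (Int.cast : ℤ → ℝ) * (quotientMatrix Φ K).map (Int.cast : ℤ → ℝ) := by
  have h := congrArg (fun M : Matrix ι ι ℚ ↦ M.map (Rat.cast : ℚ → ℝ)) (quotientMatrixRat_mul_quotientEndHom Φ K γ)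
  simpa only [map_ratCast_mul, quotientMatrixRat_map, map_intCast_map_ratCast] using h

/-- **`η(γ) ∈ End⁰(X)`**: `η(γ)_ℝ = Q_ℝ⁻¹ γ_ℝ Q_ℝ` commutes with `J_Φ`, because `γ_ℝ` commutes with
`J_{X/K} = Q_ℝ J_Φ Q_ℝ⁻¹`. [cite: Kieffer2024IsogenyGraphs, §1.4.1 ("we can identify `End(B)` with a subring of `End⁰(A)`"), p. 44] -/
theorem quotientEndHom_mem_endAlgRat (γ : endRingInt (quotientByPeriod Φ K)) :
    quotientEndHom Φ K γ ∈ endAlgRat Φ := by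
  rw [mem_endAlgRat_iff]
  set M := (quotientEndHom Φ K γ).map (Rat.cast : ℚ → ℝ)
  set Q := (quotientMatrix Φ K).map (Int.cast : ℤ → ℝ) with hQ
  set G := (γ : Matrix ι ι ℤ).map (Int.cast : ℤ → ℝ)
  set J := jMatrix Φ
  set J' := jMatrix (quotientByPeriod Φ K)
  have hu : IsUnit Q.det := isUnit_det_map_intCast _ (det_quotientMatrix_ne_zero Φ K)
  have hQM : Q * M = G * Q := quotientMatrix_mul_quotientEndHom_map Φ K γ
  have hG : G * J' = J' * G := (mem_endRingInt_iff_mul_jMatrix (quotientByPeriod Φ K)).1 γ.2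
  have hJQ : J' * Q = Q * J := jMatrix_quotientPeriod_mul Φ (quotientMatrix Φ K) (det_quotientMatrix_ne_zero Φ K)
  have h : Q * (M * J) = Q * (J * M) := by
    calc Q * (M * J) = Q * M * J := (Matrix.mul_assoc _ _ _).symm
      _ = G * (Q * J) := by rw [hQM, Matrix.mul_assoc]
      _ = G * J' * Q := by rw [← hJQ, Matrix.mul_assoc]
      _ = J' * (G * Q) := by rw [hG, Matrix.mul_assoc]
      _ = J' * Q * M := by rw [← hQM, Matrix.mul_assoc]
      _ = Q * (J * M) := by rw [hJQ, Matrix.mul_assoc]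
  calc M * J = Q⁻¹ * (Q * (M * J)) := (Matrix.nonsing_inv_mul_cancel_left _ _ hu).symm
    _ = Q⁻¹ * (Q * (J * M)) := by rw [h]
    _ = J * M := Matrix.nonsing_inv_mul_cancel_left _ _ hu

/-- `η` is injective (`Q` is invertible). [cite: Kieffer2024IsogenyGraphs, §1.4.1 ("`η : End(B) ↪ End⁰(A)`", Lemma 1.4.4), p. 44] -/
theorem quotientEndHom_injective : Injective (quotientEndHom Φ K) := fun γ δ h ↦ by
  have hu := isUnit_det_quotientMatrixRat Φ K
  have h' : (γ : Matrix ι ι ℤ).map (Int.cast : ℤ → ℚ) * quotientMatrixRat Φ K =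
      (δ : Matrix ι ι ℤ).map (Int.cast : ℤ → ℚ) * quotientMatrixRat Φ K := by
    rw [← quotientMatrixRat_mul_quotientEndHom, ← quotientMatrixRat_mul_quotientEndHom, h]
  have h'' : (γ : Matrix ι ι ℤ).map (Int.cast : ℤ → ℚ) = (δ : Matrix ι ι ℤ).map (Int.cast : ℤ → ℚ) := by
    rw [← Matrix.mul_nonsing_inv_cancel_right (quotientMatrixRat Φ K) ((γ : Matrix ι ι ℤ).map (Int.cast : ℤ → ℚ)) hu, h',
      Matrix.mul_nonsing_inv_cancel_right _ _ hu]
  exact Subtype.ext (Matrix.map_injective (Int.cast_injective (α := ℚ)) h'')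

/-- **`η(γ)` preserves the over-lattice `π⁻¹(K) = Q_ℝ⁻¹ ℤ^ι`**: `Q_ℝ x ∈ ℤ^ι ⟹ Q_ℝ (η(γ)_ℝ x) = γ (Q_ℝ x) ∈ ℤ^ι`.
[cite: Kieffer2024IsogenyGraphs, §1.4.1 Prop. 1.4.7 (proof: "`V_ℓ(α)(⋂_τ V_ℓ(τ)⁻¹ T_ℓ(A)) ⊂ ⋂_τ V_ℓ(τ)⁻¹ T_ℓ(A)`"), p. 46] -/
theorem quotientMatrix_mulVec_quotientEndHom_mulVec (γ : endRingInt (quotientByPeriod Φ K)) {x : ι → ℝ} {n : ι → ℤ}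
    (hx : (quotientMatrix Φ K).map (Int.cast : ℤ → ℝ) *ᵥ x = intVec n) :
    (quotientMatrix Φ K).map (Int.cast : ℤ → ℝ) *ᵥ ((quotientEndHom Φ K γ).map (Rat.cast : ℚ → ℝ) *ᵥ x) =
      intVec ((γ : Matrix ι ι ℤ) *ᵥ n) := by
  rw [Matrix.mulVec_mulVec, quotientMatrix_mul_quotientEndHom_map, ← Matrix.mulVec_mulVec, hx, intVec_mulVec]

/-- `π(η(γ)_ℝ x) ∈ K` whenever `π(x) ∈ K`. [cite: Kieffer2024IsogenyGraphs, §1.4.1 Prop. 1.4.7 (proof), p. 46] -/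
theorem proj_quotientEndHom_mulVec_mem (γ : endRingInt (quotientByPeriod Φ K)) {x : ι → ℝ} (hx : proj Φ x ∈ K) :
    proj Φ ((quotientEndHom Φ K γ).map (Rat.cast : ℚ → ℝ) *ᵥ x) ∈ K := by
  obtain ⟨n, hn⟩ := (proj_mem_iff_exists_quotientMatrix_mulVec_eq Φ K x).1 hx
  exact (proj_mem_iff_exists_quotientMatrix_mulVec_eq Φ K _).2 ⟨_, quotientMatrix_mulVec_quotientEndHom_mulVec Φ K γ hn⟩

end Eta

/-! ## §3 The right order of an ideal of `End(X)` inside `End⁰(X)` -/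

section RightOrder

/-- **The right order `O_r(I) = {α ∈ End⁰(X) : Iα ⊆ I}`** of a left ideal `I ⊆ End(X)`, as a subring of
`M_ι(ℚ) ⊇ End⁰(X) = endAlgRat Φ` (`σ α ∈ I` for every `σ ∈ I`, read in `M_ι(ℚ)`).
[cite: Kieffer2024IsogenyGraphs, §1.4.1 Prop. 1.4.7 ("the right order of `I`"; proof: "If `α` lies in the right order of `I`, then … `σα ∈ I`"), pp. 45–46] -/
def rightOrder (I : Ideal (endRingInt Φ)) : Subring (Matrix ι ι ℚ) where
  carrier := {M | M ∈ endAlgRat Φ ∧ ∀ σ ∈ I, ∃ τ ∈ I,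
    (τ : Matrix ι ι ℤ).map (Int.cast : ℤ → ℚ) = (σ : Matrix ι ι ℤ).map (Int.cast : ℤ → ℚ) * M}
  mul_mem' := by
    rintro M N ⟨hM, hM'⟩ ⟨hN, hN'⟩
    refine ⟨(endAlgRat Φ).mul_mem hM hN, fun σ hσ ↦ ?_⟩
    obtain ⟨τ, hτ, hτe⟩ := hM' σ hσ
    obtain ⟨υ, hυ, hυe⟩ := hN' τ hτ
    exact ⟨υ, hυ, by rw [hυe, hτe, Matrix.mul_assoc]⟩
  one_mem' := ⟨(endAlgRat Φ).one_mem, fun σ hσ ↦ ⟨σ, hσ, (Matrix.mul_one _).symm⟩⟩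
  add_mem' := by
    rintro M N ⟨hM, hM'⟩ ⟨hN, hN'⟩
    refine ⟨(endAlgRat Φ).add_mem hM hN, fun σ hσ ↦ ?_⟩
    obtain ⟨τ, hτ, hτe⟩ := hM' σ hσ
    obtain ⟨υ, hυ, hυe⟩ := hN' σ hσ
    exact ⟨τ + υ, I.add_mem hτ hυ, by rw [Subring.coe_add, Matrix.map_add Int.cast Int.cast_add, hτe, hυe, Matrix.mul_add]⟩
  zero_mem' := ⟨(endAlgRat Φ).zero_mem, fun σ _ ↦ ⟨0, I.zero_mem, by
    rw [ZeroMemClass.coe_zero, Matrix.map_zero Int.cast Int.cast_zero, Matrix.mul_zero]⟩⟩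
  neg_mem' := by
    rintro M ⟨hM, hM'⟩
    refine ⟨(endAlgRat Φ).neg_mem hM, fun σ hσ ↦ ?_⟩
    obtain ⟨τ, hτ, hτe⟩ := hM' σ hσ
    exact ⟨-τ, I.neg_mem hτ, by rw [NegMemClass.coe_neg, Matrix.map_neg Int.cast Int.cast_neg, hτe, Matrix.mul_neg]⟩

/-- Membership in the right order. [cite: Kieffer2024IsogenyGraphs, §1.4.1 Prop. 1.4.7, p. 45] -/
theorem mem_rightOrder_iff {I : Ideal (endRingInt Φ)} {M : Matrix ι ι ℚ} :
    M ∈ rightOrder Φ I ↔ M ∈ endAlgRat Φ ∧ ∀ σ ∈ I, ∃ τ ∈ I,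
      (τ : Matrix ι ι ℤ).map (Int.cast : ℤ → ℚ) = (σ : Matrix ι ι ℤ).map (Int.cast : ℤ → ℚ) * M :=
  Iff.rfl

/-- `O_r(I) ⊆ End⁰(X)`. [cite: Kieffer2024IsogenyGraphs, §1.4.1 Prop. 1.4.7, p. 45] -/
theorem rightOrder_le_endAlgRat (I : Ideal (endRingInt Φ)) : rightOrder Φ I ≤ (endAlgRat Φ).toSubring :=
  fun _ hM ↦ hM.1

/-- An integral element `α ∈ End(X)` lies in `O_r(I)` iff `σα ∈ I` for all `σ ∈ I` (`Iα ⊆ I`).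
[cite: Kieffer2024IsogenyGraphs, §1.4.1 Prop. 1.4.7 (proof: "Because `I` is a kernel ideal, we have `Iα ⊂ I`, i.e. `α` lies in the right order of `I`"), p. 46] -/
theorem map_intCast_mem_rightOrder_iff {I : Ideal (endRingInt Φ)} {α : endRingInt Φ} :
    (α : Matrix ι ι ℤ).map (Int.cast : ℤ → ℚ) ∈ rightOrder Φ I ↔ ∀ σ ∈ I, σ * α ∈ I := by
  rw [mem_rightOrder_iff]
  constructor
  · rintro ⟨-, h⟩ σ hσ
    obtain ⟨τ, hτ, hτe⟩ := h σ hσ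
    rw [← map_intCast_mul_rat, ← Subring.coe_mul] at hτe
    rwa [← Subtype.ext (Matrix.map_injective (Int.cast_injective (α := ℚ)) hτe)]
  · intro h
    exact ⟨(mem_endRingInt_iff Φ).1 α.2, fun σ hσ ↦ ⟨σ * α, h σ hσ, by rw [Subring.coe_mul, map_intCast_mul_rat]⟩⟩

/-- An `α ∈ End(X)` commuting with every element of `I` lies in `O_r(I)` (`σα = ασ ∈ I`); in particular
`End(X) ⊆ O_r(I)` when `End(X)` is commutative. [cite: Kieffer2024IsogenyGraphs, §1.4.1 Prop. 1.4.7, pp. 45–46] -/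
theorem map_intCast_mem_rightOrder_of_comm {I : Ideal (endRingInt Φ)} {α : endRingInt Φ}
    (h : ∀ σ ∈ I, σ * α = α * σ) : (α : Matrix ι ι ℤ).map (Int.cast : ℤ → ℚ) ∈ rightOrder Φ I :=
  (map_intCast_mem_rightOrder_iff Φ).2 fun σ hσ ↦ by
    rw [h σ hσ]
    exact I.mul_mem_left α hσ

end RightOrder

/-! ## §4 Proposition 1.4.7: `End(X/H(I)) = O_r(I)` for a kernel ideal `I` -/

section Prop147

/-- **`η(End(X/K)) ⊆ O_r(I(K))` for every finite subgroup `K`** (the inclusion "`⊆`" of Prop. 1.4.7, which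
holds for the ideal `I(K) = {σ : K ⊆ ker σ}` of any finite `K`): for `γ ∈ End(X/K)` and `σ ∈ I(K)`, the
rational matrix `σ · η(γ)` is integral — it maps `ℤ^ι ⊆ π⁻¹(K)` into `σ(π⁻¹(K)) ⊆ ℤ^ι` — commutes with `J`,
and kills `K` (`η(γ)` preserves `π⁻¹(K)`), so it lies in `I(K)`.
[cite: Kieffer2024IsogenyGraphs, §1.4.1 Prop. 1.4.7 (proof: "In particular, `V_ℓ(σα)(T_ℓ(A)) ⊂ T_ℓ(A)`, so `σα ∈ End(A)`"), p. 46] -/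
theorem range_quotientEndHom_le_rightOrder (K : AddSubgroup (ComplexTorus Φ)) [Finite K] :
    (quotientEndHom Φ K).range ≤ rightOrder Φ (idealOfSubgroup Φ K) := by
  rintro M ⟨γ, rfl⟩
  refine ⟨quotientEndHom_mem_endAlgRat Φ K γ, fun σ hσ ↦ ?_⟩
  rw [mem_idealOfSubgroup_iff] at hσ
  set Mr := (quotientEndHom Φ K γ).map (Rat.cast : ℚ → ℝ) with hMr
  set S := (σ : Matrix ι ι ℤ).map (Int.cast : ℤ → ℝ) with hS
  -- `σ_ℝ (η(γ)_ℝ x) ∈ ℤ^ι` whenever `π(x) ∈ K`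
  have hint : ∀ x : ι → ℝ, proj Φ x ∈ K → ∃ k : ι → ℤ, S *ᵥ (Mr *ᵥ x) = intVec k := fun x hx ↦
    (proj_mem_ker_mapMatrixHom_iff Φ Φ (σ : Matrix ι ι ℤ) _).1 (hσ (proj_quotientEndHom_mulVec_mem Φ K γ hx))
  -- the columns of `σ η(γ)`: `x = e_j` (`π(e_j) = 0 ∈ K`)
  have hcol : ∀ j : ι, ∃ k : ι → ℤ, (S * Mr) *ᵥ Pi.single j 1 = intVec k := fun j ↦ by
    obtain ⟨k, hk⟩ := hint (Pi.single j 1) (by rw [← intVec_single, proj_intVec]; exact K.zero_mem)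
    exact ⟨k, by rw [← Matrix.mulVec_mulVec, hk]⟩
  choose k hk using hcol
  set τ : Matrix ι ι ℤ := Matrix.of fun i j ↦ k j i with hτ
  have hτr : τ.map (Int.cast : ℤ → ℝ) = S * Mr := exists_map_intCast_eq_of_mulVec_single hk
  have hτq' : (τ.map (Int.cast : ℤ → ℚ)).map (Rat.cast : ℚ → ℝ) =
      ((σ : Matrix ι ι ℤ).map (Int.cast : ℤ → ℚ) * quotientEndHom Φ K γ).map (Rat.cast : ℚ → ℝ) := by
    rw [map_ratCast_mul, map_intCast_map_ratCast, map_intCast_map_ratCast, hτr]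
  have hτq : τ.map (Int.cast : ℤ → ℚ) = (σ : Matrix ι ι ℤ).map (Int.cast : ℤ → ℚ) * quotientEndHom Φ K γ :=
    Matrix.map_injective (Rat.cast_injective (α := ℝ)) hτq'
  -- `τ ∈ End(X)`: `τ_ℝ = σ_ℝ η(γ)_ℝ` commutes with `J`
  have hτend : τ ∈ endRingInt Φ := by
    rw [mem_endRingInt_iff_mul_jMatrix, hτr, Matrix.mul_assoc,
      (mem_endAlgRat_iff Φ _).1 (quotientEndHom_mem_endAlgRat Φ K γ), ← Matrix.mul_assoc,
      (mem_endRingInt_iff_mul_jMatrix Φ).1 σ.2, Matrix.mul_assoc]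
  refine ⟨⟨τ, hτend⟩, ?_, hτq⟩
  -- `K ⊆ ker τ`
  rw [mem_idealOfSubgroup_iff]
  intro t ht
  rw [← proj_lift Φ t] at ht ⊢
  obtain ⟨k', hk'⟩ := hint _ ht
  exact (proj_mem_ker_mapMatrixHom_iff Φ Φ τ _).2 ⟨k', by rw [hτr, ← Matrix.mulVec_mulVec, hk']⟩

variable (I : Ideal (endRingInt Φ))

/-- **`π⁻¹(H(I)) = {x : σ_ℝ x ∈ ℤ^ι for all σ ∈ I}`** (the global over-lattice of `Λ = ℤ^ι` attached to
`H(I) = ⋂_{σ ∈ I} ker σ`; its `ℤ_p`-span is `⋂_σ V_p(σ)⁻¹ T_p X`, Lemma 1.4.3).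
[cite: Kieffer2024IsogenyGraphs, §1.4.1 Def. 1.4.1 and Lemma 1.4.3, pp. 43–44] -/
theorem proj_mem_kernelSubgroup_iff (x : ι → ℝ) :
    proj Φ x ∈ kernelSubgroup Φ I ↔ ∀ σ ∈ I, ∃ n : ι → ℤ, (σ : Matrix ι ι ℤ).map (Int.cast : ℤ → ℝ) *ᵥ x = intVec n := by
  rw [mem_kernelSubgroup_iff]
  refine forall₂_congr fun σ _ ↦ ?_
  rw [← proj_mem_ker_mapMatrixHom_iff Φ Φ (σ : Matrix ι ι ℤ) x, mem_ker_mapMatrixHom_iff]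

variable [Finite (kernelSubgroup Φ I)]

/-- **`O_r(I) ⊆ η(End(X/H(I)))`** (the inclusion "`⊇`" of Prop. 1.4.7, valid for every `I` with `H(I)`
finite): for `M ∈ O_r(I)`, `σ M = τ ∈ I` for all `σ ∈ I`, so `M_ℝ` maps `π⁻¹(H(I)) = {x : σ_ℝ x ∈ ℤ^ι ∀σ ∈ I}`
into itself; hence `γ = Q M Q⁻¹` is integral, commutes with `J_{X/H(I)} = Q J Q⁻¹`, i.e. `γ ∈ End(X/H(I))`, and
`η(γ) = M`. [cite: Kieffer2024IsogenyGraphs, §1.4.1 Prop. 1.4.7 (proof: "If `α` lies in the right order of `I`, then (1) is satisfied for each `σ`, as `σα ∈ I`"), p. 46] -/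
theorem rightOrder_le_range_quotientEndHom : rightOrder Φ I ≤ (quotientEndHom Φ (kernelSubgroup Φ I)).range := by
  rintro M ⟨hM, hM'⟩
  set K := kernelSubgroup Φ I with hK
  set Qq := quotientMatrixRat Φ K with hQq
  set Q := (quotientMatrix Φ K).map (Int.cast : ℤ → ℝ) with hQ
  set Mr := M.map (Rat.cast : ℚ → ℝ) with hMr
  have hu : IsUnit Qq.det := isUnit_det_quotientMatrixRat Φ K
  have huR : IsUnit Q.det := isUnit_det_map_intCast _ (det_quotientMatrix_ne_zero Φ K)
  -- the candidate `γ = Q M Q⁻¹`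
  set G : Matrix ι ι ℚ := Qq * M * Qq⁻¹ with hG
  have hGQ : G * Qq = Qq * M := Matrix.nonsing_inv_mul_cancel_right _ _ hu
  have hGQr : G.map (Rat.cast : ℚ → ℝ) * Q = Q * Mr := by
    have h := congrArg (fun N : Matrix ι ι ℚ ↦ N.map (Rat.cast : ℚ → ℝ)) hGQ
    simp only [map_ratCast_mul, hQq, quotientMatrixRat_map] at h
    rw [hQ, hMr]
    exact h
  -- `M_ℝ` preserves `π⁻¹(H(I))`
  have hstab : ∀ x : ι → ℝ, proj Φ x ∈ K → proj Φ (Mr *ᵥ x) ∈ K := fun x hx ↦ by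
    rw [hK, proj_mem_kernelSubgroup_iff] at hx ⊢
    intro σ hσ
    obtain ⟨τ, hτ, hτe⟩ := hM' σ hσ
    obtain ⟨n, hn⟩ := hx τ hτ
    have hτr : (τ : Matrix ι ι ℤ).map (Int.cast : ℤ → ℝ) = (σ : Matrix ι ι ℤ).map (Int.cast : ℤ → ℝ) * Mr := by
      have h := congrArg (fun N : Matrix ι ι ℚ ↦ N.map (Rat.cast : ℚ → ℝ)) hτe
      simpa only [map_ratCast_mul, map_intCast_map_ratCast] using h
    exact ⟨n, by rw [Matrix.mulVec_mulVec, ← hτr, hn]⟩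
  -- integrality of `γ`: its columns `γ_ℝ e_j = Q_ℝ M_ℝ x_j` with `Q_ℝ x_j = e_j`
  have hbij := ((isIsogeny_iff_mulVec_bijective Φ (quotientByPeriod Φ K) (quotientMatrix Φ K)).1
    (isIsogeny_quotientBy Φ K)).2
  choose x hx using fun j : ι ↦ hbij.2 (Pi.single j (1 : ℝ))
  have hcol : ∀ j : ι, ∃ k : ι → ℤ, G.map (Rat.cast : ℚ → ℝ) *ᵥ Pi.single j 1 = intVec k := fun j ↦ by
    have hxj : proj Φ (x j) ∈ K :=
      (proj_mem_iff_exists_quotientMatrix_mulVec_eq Φ K _).2 ⟨Pi.single j 1, by rw [hx j, intVec_single]⟩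
    obtain ⟨k, hk⟩ := (proj_mem_iff_exists_quotientMatrix_mulVec_eq Φ K _).1 (hstab _ hxj)
    exact ⟨k, by rw [← hx j, Matrix.mulVec_mulVec, hGQr, ← Matrix.mulVec_mulVec, hk]⟩
  choose k hk using hcol
  set γ : Matrix ι ι ℤ := Matrix.of fun i j ↦ k j i with hγ
  have hγr : γ.map (Int.cast : ℤ → ℝ) = G.map (Rat.cast : ℚ → ℝ) := exists_map_intCast_eq_of_mulVec_single hk
  have hγq' : (γ.map (Int.cast : ℤ → ℚ)).map (Rat.cast : ℚ → ℝ) = G.map (Rat.cast : ℚ → ℝ) := by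
    rw [map_intCast_map_ratCast, hγr]
  have hγq : γ.map (Int.cast : ℤ → ℚ) = G := Matrix.map_injective (Rat.cast_injective (α := ℝ)) hγq'
  -- `γ ∈ End(X/H(I))`: `γ_ℝ J' = J' γ_ℝ` with `J' Q = Q J`, `γ_ℝ Q = Q M_ℝ`, `M_ℝ J = J M_ℝ`
  have hγQ : γ.map (Int.cast : ℤ → ℝ) * Q = Q * Mr := by rw [hγr, hGQr]
  have hMJ : Mr * jMatrix Φ = jMatrix Φ * Mr := (mem_endAlgRat_iff Φ M).1 hM
  have hJQ : jMatrix (quotientByPeriod Φ K) * Q = Q * jMatrix Φ :=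
    jMatrix_quotientPeriod_mul Φ (quotientMatrix Φ K) (det_quotientMatrix_ne_zero Φ K)
  have hγend : γ ∈ endRingInt (quotientByPeriod Φ K) := by
    rw [mem_endRingInt_iff_mul_jMatrix]
    set J' := jMatrix (quotientByPeriod Φ K)
    set Gr := γ.map (Int.cast : ℤ → ℝ)
    have h1 : Gr * J' * Q = J' * Gr * Q := by
      calc Gr * J' * Q = Gr * (Q * jMatrix Φ) := by rw [Matrix.mul_assoc, hJQ]
        _ = Q * (Mr * jMatrix Φ) := by rw [← Matrix.mul_assoc, hγQ, Matrix.mul_assoc]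
        _ = Q * jMatrix Φ * Mr := by rw [hMJ, Matrix.mul_assoc]
        _ = J' * (Gr * Q) := by rw [← hJQ, Matrix.mul_assoc, ← hγQ]
        _ = J' * Gr * Q := (Matrix.mul_assoc _ _ _).symm
    calc Gr * J' = Gr * J' * Q * Q⁻¹ := (Matrix.mul_nonsing_inv_cancel_right _ _ huR).symm
      _ = J' * Gr * Q * Q⁻¹ := by rw [h1]
      _ = J' * Gr := Matrix.mul_nonsing_inv_cancel_right _ _ huR
  refine ⟨⟨γ, hγend⟩, ?_⟩
  rw [quotientEndHom_apply]
  change Qq⁻¹ * γ.map (Int.cast : ℤ → ℚ) * Qq = M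
  rw [hγq, hG, Matrix.mul_assoc Qq M, Matrix.nonsing_inv_mul_cancel_left _ _ hu, Matrix.nonsing_inv_mul_cancel_right _ _ hu]

/-- Every `α ∈ End(X)` commuting with `I` descends to `X/H(I)`: `α_ℚ = η(γ)` for some `γ ∈ End(X/H(I))`
(e.g. all of `End(X)` when `End(X)` is commutative). [cite: Kieffer2024IsogenyGraphs, §1.4.1 Prop. 1.4.7, pp. 45–46] -/
theorem exists_quotientEndHom_eq_of_comm {α : endRingInt Φ} (h : ∀ σ ∈ I, σ * α = α * σ) :
    ∃ γ : endRingInt (quotientByPeriod Φ (kernelSubgroup Φ I)),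
      quotientEndHom Φ (kernelSubgroup Φ I) γ = (α : Matrix ι ι ℤ).map (Int.cast : ℤ → ℚ) :=
  RingHom.mem_range.1 (rightOrder_le_range_quotientEndHom Φ I (map_intCast_mem_rightOrder_of_comm Φ h))

variable {I}

/-- **PROPOSITION 1.4.7. "Let `I ⊂ End(A)` be a kernel ideal. Then the endomorphism ring of `A/H(I)`, seen as
a subring of `End⁰(A)`, is precisely the right order of `I`."** — at torus level: `η(End(X/H(I))) = O_r(I)`
inside `M_ι(ℚ) ⊇ End⁰(X)`. [cite: Kieffer2024IsogenyGraphs, §1.4.1 Prop. 1.4.7, pp. 45–46] -/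
theorem IsKernelIdeal.range_quotientEndHom_eq (hI : IsKernelIdeal Φ I) :
    (quotientEndHom Φ (kernelSubgroup Φ I)).range = rightOrder Φ I := by
  refine le_antisymm ?_ (rightOrder_le_range_quotientEndHom Φ I)
  have h := range_quotientEndHom_le_rightOrder Φ (kernelSubgroup Φ I)
  rwa [hI] at h

/-- Prop. 1.4.7 elementwise: `M ∈ O_r(I) ↔ M = η(γ)` for some `γ ∈ End(X/H(I))`.
[cite: Kieffer2024IsogenyGraphs, §1.4.1 Prop. 1.4.7, pp. 45–46] -/
theorem IsKernelIdeal.mem_rightOrder_iff (hI : IsKernelIdeal Φ I) {M : Matrix ι ι ℚ} :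
    M ∈ rightOrder Φ I ↔ ∃ γ : endRingInt (quotientByPeriod Φ (kernelSubgroup Φ I)),
      quotientEndHom Φ (kernelSubgroup Φ I) γ = M := by
  rw [← hI.range_quotientEndHom_eq Φ, RingHom.mem_range]

/-- **`End(X/H(I)) ≅ O_r(I)`** as rings, via `η`, for a kernel ideal `I`.
[cite: Kieffer2024IsogenyGraphs, §1.4.1 Prop. 1.4.7, pp. 45–46] -/
def IsKernelIdeal.quotientEndEquivRightOrder (hI : IsKernelIdeal Φ I) :
    endRingInt (quotientByPeriod Φ (kernelSubgroup Φ I)) ≃+* rightOrder Φ I :=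
  (RingEquiv.ofBijective (quotientEndHom Φ (kernelSubgroup Φ I)).rangeRestrict
      ⟨fun _ _ h ↦ quotientEndHom_injective Φ _ (congrArg Subtype.val h),
        RingHom.rangeRestrict_surjective _⟩).trans
    (RingEquiv.subringCongr (hI.range_quotientEndHom_eq Φ))

/-- The isomorphism is `η` on underlying matrices. [cite: Kieffer2024IsogenyGraphs, §1.4.1 Prop. 1.4.7, pp. 45–46] -/
@[simp] theorem IsKernelIdeal.coe_quotientEndEquivRightOrder (hI : IsKernelIdeal Φ I)
    (γ : endRingInt (quotientByPeriod Φ (kernelSubgroup Φ I))) :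
    (hI.quotientEndEquivRightOrder Φ γ : Matrix ι ι ℚ) = quotientEndHom Φ (kernelSubgroup Φ I) γ :=
  rfl

end Prop147

end ComplexTorus

end Literature.Geometry.Kaehler
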